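import Literature.Analysis.FluidPDE.SawtoothCascadeDriftFree
import Literature.Analysis.FluidPDE.SawtoothCascadeSmooth
import Literature.Analysis.FluidPDE.NavierStokesConcentrationTools
import Literature.Analysis.FluidPDE.CheskidovAssemblyTools
import Literature.Analysis.FunctionSpaces.TorusLinearisedNSShear
import Literature.Analysis.FunctionSpaces.TorusInverseLaplacianCalculus
import Summits.AnomalousDissipation.AnomalousDissipation.Theorems.SawtoothPulseCascadeK3LocalisedClosureExistenceAssembly
import HarnessLib

/-!
# K3loc, line `DriftFree` — helper: Grenier's ansatz `U = ū + L` and the reduction of `ApproximateSolution` to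
# estimates on the LINEARISED response

Helper file of the lead prover for the crux `K3LocalisedClosure` (stmt-AnomalousDissipation-19492), route
`SawtoothPulseCascade`, line `DriftFree` (skeleton v3), stub `stub_approximateSolution` (XL, load-bearing):
`K2LinearisedCascadeGrowth → ∀ box, DriftFree.ApproximateSolution ⟨γ, 1/4, 2, 1, ρN⟩ (γ² − 3)`.  It removes every
piece of Navier–Stokes bookkeeping from that stub, leaving exactly the analytic estimates on the linearised cascade
response that ad-ideate-p2 ROUND-4 §2 names as the risk (`approximateSolution_of_linearisedResponse`):

* §A1 the carrier `ū = P.field` on `[0,1)`: at rest at `t = 0` (`field_zero`), NO self-advection `(ū·∇)ū = 0`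
  (`convect_field_field`: one shear at a time, `SawtoothCascade` Parts 9–10), pointwise strain
  `⟪ξ, (ξ·∇)ū⟫ ≤ ½ Σⱼ(rateH j + rateV j) ‖ξ‖²` (`inner_convect_field_le`, from
  `Torus.two_mul_abs_inner_convect_le_of_shear` and `|U_j'| ≤ 1`; the sum has one live term), the rate sum being a
  finite sum below `tStart J` and continuous on every `[0, T]`, `T < 1`;
* §A2 GRENIER'S ANSATZ (Grenier 2000 §2; Cheskidov–Luo's "the background absorbs the force"): if `L` solves the
  Navier–Stokes equations LINEARISED at `ū` with the heat-lag source `νΔū` on `[0,1)`, then `U = ū + L` is a classical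
  Navier–Stokes solution with force `∂ₜū + (L·∇)L` (`isClassicalNSSolutionOn_field_add`; `∂ₜū = planarForce P` on
  `[0,1)` by definition, `planarForce_eq`);
* §A3 hence `ApproximateSolution P r` follows from: for every lag `A` and `ε > 0`, for all small `ν`, a classical
  linearised response `L` from rest with a continuous pointwise strain bound `Λ_L` on `[0, horizon r ν A]`,
  `∫₀ᵀ ‖L‖² ≤ εν`, and `(∫₀ᵗ e^{∫ₛᵗ(½Σrate + Λ_L)⁺} ‖(L·∇)L(s)‖_{L²} ds)² ≤ εν` — the witness being `U = ū + L`,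
  `ρ = (L·∇)L`, `Λ = ½Σrate + Λ_L`.  The existence of `L` on closed windows is the tree's
  `Torus.linearisedNSForced_exists`; its `L²` size per phase is what the crux `K2″` caps (after realigning the
  `x_∥`-independent heat-lag source of each half pulse to one comb-class injection at the pulse start, legitimate on
  the box since `νN_j²` stays exponentially small up to the horizon); the sup-norm / Lipschitz control `Λ_L` is the
  named open risk.
-/

-- `Summit.<Summit>.<Problem>`: single-conjunct summit, the duplicate namespace segment is deliberate.
set_option linter.dupNamespace false

noncomputable section

namespace Summit.AnomalousDissipation.AnomalousDissipation.Theorems.SawtoothPulseCascade.DriftFreeApprox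

open scoped InnerProductSpace ENNReal NNReal
open MeasureTheory Set Filter Topology
open Literature.Analysis Literature.Analysis.FunctionSpaces Literature.Analysis.FluidPDE
open Literature.Analysis.FluidPDE.SawtoothCascade
open Literature.Analysis.FluidPDE.SawtoothCascade.DriftFree

/-! ## §A1 The carrier: at rest at `t = 0`, no self-advection, pointwise strain `≤ rate/2` -/

section Carrier

variable (P : CascadeParams)

/-- The cascade is at rest at `t = 0`. [folklore] -/
theorem field_zero : P.field 0 = 0 := by
  funext x
  have hH : ∀ j, P.rateH j 0 = 0 := fun j =>
    P.rateH_of_le_tStart (CascadeParams.tStart_nonneg j)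
  have hV : ∀ j, P.rateV j 0 = 0 := fun j =>
    P.rateV_of_le (by linarith [CascadeParams.tStart_nonneg j, CascadeParams.tHalf_pos j])
  simp only [CascadeParams.field, hH, hV, zero_mul, tsum_zero]
  ext i; fin_cases i <;> simp

/-- **A shear has no self-advection**: `(ū·∇)ū = 0` on `[0,1)` (on each half-slot the field is one shear whose
gradient is transverse to it). [folklore] -/
theorem convect_field_field (hδ₀ : 0 < P.δ₀) (hd : 0 < P.d) {t : ℝ} (ht : t ∈ Ico (0 : ℝ) 1)
    (x : UnitAddTorus (Fin 2)) :
    FunctionSpaces.Torus.convect (P.field t) (P.field t) x = 0 := by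
  have hfs : CascadeFieldSmooth P := cascadeFieldSmooth P hδ₀ hd
  have hsm : FunctionSpaces.Torus.IsSmooth (P.field t) := hfs.isSmooth_slice ht
  show FunctionSpaces.Torus.fderiv (P.field t) x (P.field t x) = 0
  rw [FunctionSpaces.Torus.fderiv_apply_eq_sum_partialDeriv (hsm.isContDiff (by simp)) x (P.field t x),
    Fin.sum_univ_two]
  obtain ⟨j, h | h⟩ := DriftFreeExistence.exists_mem_slot ht
  · obtain ⟨h0, h1⟩ := P.partialDeriv_field_of_mem_H h x
    have hc : P.field t x 1 = 0 := by rw [P.field_eq_of_mem_H h x]; simp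
    rw [h0, h1, hc, smul_zero, zero_smul, add_zero]
  · obtain ⟨h1, h0⟩ := P.partialDeriv_field_of_mem_V h x
    have hc : P.field t x 0 = 0 := by rw [P.field_eq_of_mem_V h x]; simp
    rw [h0, h1, hc, smul_zero, zero_smul, add_zero]

/-- **Pointwise strain of the carrier**: `⟪ξ, (ξ·∇)ū(t,x)⟫ ≤ ½(Σⱼ rateH j t + rateV j t) ‖ξ‖²` on `[0,1)` (one
shear at a time, slope `|U_j'| ≤ 1`; `2|ξ₁ξ₂| ≤ ‖ξ‖²`). [folklore] -/
theorem inner_convect_field_le (hγ : 0 ≤ P.γ) (hδ₀ : 0 < P.δ₀) (hd : 0 < P.d) {t : ℝ}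
    (ht : t ∈ Ico (0 : ℝ) 1) (x : UnitAddTorus (Fin 2)) (ξ : EuclideanSpace ℝ (Fin 2)) :
    ⟪ξ, FunctionSpaces.Torus.convect (fun _ => ξ) (P.field t) x⟫_ℝ ≤
      (∑' j, (P.rateH j t + P.rateV j t)) / 2 * ‖ξ‖ ^ 2 := by
  have hfs : CascadeFieldSmooth P := cascadeFieldSmooth P hδ₀ hd
  have hsm : FunctionSpaces.Torus.IsSmooth (P.field t) := hfs.isSmooth_slice ht
  have hδ : ∀ j, 0 < P.δ j := fun j => P.δ_pos hδ₀ hd j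
  obtain ⟨j, h | h⟩ := DriftFreeExistence.exists_mem_slot ht
  · -- H half-slot: only `rateH j t` is alive
    have hsum : ∑' i, (P.rateH i t + P.rateV i t) = P.rateH j t := by
      rw [tsum_eq_single j fun i hij => by rw [P.rateH_eq_zero_of_mem_H_of_ne h hij, P.rateV_eq_zero_of_mem_H h, add_zero]]
      rw [P.rateV_eq_zero_of_mem_H h, add_zero]
    obtain ⟨h0, h1⟩ := P.partialDeriv_field_of_mem_H h x
    have key := FunctionSpaces.Torus.two_mul_abs_inner_convect_le_of_shear (w := fun _ => ξ) hsm
      (k := (1 : Fin 2)) (m := 0) (by decide) (x := x) (c := P.rateH j t * deriv (P.U j) (Torus.repr x 1))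
      (fun i hi => by
        fin_cases i
        · exact h0
        · exact absurd rfl hi) h1
    rw [hsum, real_inner_comm]
    have hc : |P.rateH j t * deriv (P.U j) (Torus.repr x 1)| ≤ P.rateH j t := by
      rw [abs_mul, abs_of_nonneg (P.rateH_nonneg hγ j t)]
      calc P.rateH j t * |deriv (P.U j) (Torus.repr x 1)| ≤ P.rateH j t * 1 :=
            mul_le_mul_of_nonneg_left (P.abs_deriv_U_le_one (hδ j) _) (P.rateH_nonneg hγ j t)
        _ = P.rateH j t := mul_one _
    have := le_abs_self ⟪FunctionSpaces.Torus.convect (fun _ => ξ) (P.field t) x, ξ⟫_ℝ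
    nlinarith [sq_nonneg ‖ξ‖, hc, key]
  · have hsum : ∑' i, (P.rateH i t + P.rateV i t) = P.rateV j t := by
      rw [tsum_eq_single j fun i hij => by rw [P.rateV_eq_zero_of_mem_V_of_ne h hij, P.rateH_eq_zero_of_mem_V h, add_zero]]
      rw [P.rateH_eq_zero_of_mem_V h, zero_add]
    obtain ⟨h1, h0⟩ := P.partialDeriv_field_of_mem_V h x
    have key := FunctionSpaces.Torus.two_mul_abs_inner_convect_le_of_shear (w := fun _ => ξ) hsm
      (k := (0 : Fin 2)) (m := 1) (by decide) (x := x) (c := P.rateV j t * deriv (P.U j) (Torus.repr x 0))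
      (fun i hi => by
        fin_cases i
        · exact absurd rfl hi
        · exact h1) h0
    rw [hsum, real_inner_comm]
    have hc : |P.rateV j t * deriv (P.U j) (Torus.repr x 0)| ≤ P.rateV j t := by
      rw [abs_mul, abs_of_nonneg (P.rateV_nonneg hγ j t)]
      calc P.rateV j t * |deriv (P.U j) (Torus.repr x 0)| ≤ P.rateV j t * 1 :=
            mul_le_mul_of_nonneg_left (P.abs_deriv_U_le_one (hδ j) _) (P.rateV_nonneg hγ j t)
        _ = P.rateV j t := mul_one _
    have := le_abs_self ⟪FunctionSpaces.Torus.convect (fun _ => ξ) (P.field t) x, ξ⟫_ℝ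
    nlinarith [sq_nonneg ‖ξ‖, hc, key]

/-- Below `tStart J` the rate sum is the finite sum over the phases `j < J`. [folklore] -/
theorem tsum_rate_eq_sum_of_lt {J : ℕ} {t : ℝ} (ht : t < CascadeParams.tStart J) :
    ∑' j, (P.rateH j t + P.rateV j t) = ∑ j ∈ Finset.range J, (P.rateH j t + P.rateV j t) := by
  refine tsum_eq_sum fun j hj => ?_
  have hJj : J ≤ j := by simpa using hj
  have h1 : t ≤ CascadeParams.tStart j := ht.le.trans (CascadeParams.tStart_strictMono.monotone hJj)
  rw [P.rateH_of_le_tStart h1, P.rateV_of_le (h1.trans (le_add_of_nonneg_right (CascadeParams.tHalf_pos j).le)),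
    add_zero]

/-- The carrier strain rate `½ Σⱼ (rateH j + rateV j)` is continuous on every `[0, T]`, `T < 1`. [folklore] -/
theorem continuousOn_rate_sum {T : ℝ} (hT : T < 1) :
    ContinuousOn (fun t => (∑' j, (P.rateH j t + P.rateV j t)) / 2) (Icc 0 T) := by
  obtain ⟨J, hJ⟩ : ∃ J, T < CascadeParams.tStart J :=
    ((tendsto_order.1 CascadeParams.tendsto_tStart).1 T hT).exists
  have hc : Continuous fun t => (∑ j ∈ Finset.range J, (P.rateH j t + P.rateV j t)) / 2 :=
    (continuous_finsetSum _ fun j _ => (P.continuous_rateH j).add (P.continuous_rateV j)).div_const _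
  refine hc.continuousOn.congr fun t ht => ?_
  simp only
  rw [tsum_rate_eq_sum_of_lt P (lt_of_le_of_lt ht.2 hJ)]

end Carrier


/-! ## §A2 Grenier's ansatz `U = ū + L`: the Navier–Stokes bookkeeping -/

section Ansatz

variable (P : CascadeParams) {ν : ℝ} {L : ℝ → UnitAddTorus (Fin 2) → EuclideanSpace ℝ (Fin 2)}
  {q : ℝ → UnitAddTorus (Fin 2) → ℝ}

/-- On `[0,1)` the planar force IS the one-sided time derivative of the carrier. [folklore] -/
theorem planarForce_eq {t : ℝ} (ht : t ∈ Ico (0 : ℝ) 1) (x : UnitAddTorus (Fin 2)) :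
    planarForce P t x = FunctionSpaces.Torus.timeDerivWithin (Ico (0 : ℝ) 1) P.field t x := by
  simp [planarForce, if_pos ht.2]

/-- **Grenier's ansatz.** If `L` (with pressure `q`) is a classical solution on `[0,1) × 𝕋²` of the Navier–Stokes
equations LINEARISED at the cascade carrier `ū` with the heat-lag source `νΔū`,
`∂ₜL + (ū·∇)L + (L·∇)ū = νΔL − ∇q + νΔū`, `div L = 0`, then `U = ū + L` is a classical solution of the
Navier–Stokes system with force `∂ₜū + (L·∇)L` and pressure `q` (`(ū·∇)ū = 0` for the shear carrier;
Grenier 2000 §2, the approximate solution; Cheskidov–Luo's "background absorbs the force"). [folklore] -/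
theorem isClassicalNSSolutionOn_field_add (hδ₀ : 0 < P.δ₀) (hd : 0 < P.d)
    (hL : FunctionSpaces.Torus.IsSmoothSpaceTimeOn (Ico (0 : ℝ) 1) L)
    (hq : FunctionSpaces.Torus.IsSmoothSpaceTimeOn (Ico (0 : ℝ) 1) q)
    (hdiv : ∀ t ∈ Ico (0 : ℝ) 1, FunctionSpaces.Torus.IsDivFree (L t))
    (hlin : ∀ t ∈ Ico (0 : ℝ) 1, ∀ x,
      FunctionSpaces.Torus.timeDerivWithin (Ico (0 : ℝ) 1) L t x + FunctionSpaces.Torus.convect (P.field t) (L t) x +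
          FunctionSpaces.Torus.convect (L t) (P.field t) x =
        ν • FunctionSpaces.Torus.laplacian (L t) x - FunctionSpaces.Torus.gradient (q t) x +
          ν • FunctionSpaces.Torus.laplacian (P.field t) x) :
    FunctionSpaces.Torus.IsClassicalNSSolutionOn (Ico (0 : ℝ) 1) ν
      (planarForce P + fun t x => FunctionSpaces.Torus.convect (L t) (L t) x)
      (fun t x => P.field t x + L t x) q where
  smooth_velocity := (cascadeFieldSmooth P hδ₀ hd).add hL
  smooth_pressure := hq
  momentum t ht x := by
    have hfs : CascadeFieldSmooth P := cascadeFieldSmooth P hδ₀ hd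
    have hU : UniqueDiffOn ℝ (Ico (0 : ℝ) 1) := uniqueDiffOn_Ico 0 1
    have hFt : FunctionSpaces.Torus.IsSmooth (P.field t) := hfs.isSmooth_slice ht
    have hLt : FunctionSpaces.Torus.IsSmooth (L t) := hL.isSmooth_slice ht
    have hF1 : FunctionSpaces.Torus.IsContDiff 1 (P.field t) := hFt.isContDiff (by simp)
    have hL1 : FunctionSpaces.Torus.IsContDiff 1 (L t) := hLt.isContDiff (by simp)
    have h2 := hlin t ht x
    have h3 : FunctionSpaces.Torus.timeDerivWithin (Ico (0 : ℝ) 1) L t x =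
        ν • FunctionSpaces.Torus.laplacian (L t) x - FunctionSpaces.Torus.gradient (q t) x +
          ν • FunctionSpaces.Torus.laplacian (P.field t) x - FunctionSpaces.Torus.convect (P.field t) (L t) x -
          FunctionSpaces.Torus.convect (L t) (P.field t) x := by
      rw [← h2]; abel
    rw [FunctionSpaces.Torus.timeDerivWithin_add hfs hL hU ht x,
      FluidPDE.Torus.convect_add_left (P.field t) (L t) (fun y => P.field t y + L t y) x,
      FluidPDE.Torus.convect_add_right (P.field t) hF1 hL1 x, FluidPDE.Torus.convect_add_right (L t) hF1 hL1 x,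
      FluidPDE.Torus.laplacian_add_apply hFt hLt x, convect_field_field P hδ₀ hd ht x, ← planarForce_eq P ht x,
      smul_add, Pi.add_apply, Pi.add_apply, h3]
    abel
  divFree t ht := by
    have hfs : CascadeFieldSmooth P := cascadeFieldSmooth P hδ₀ hd
    exact (DriftFreeExistence.isDivFree_field P ht).add ((hfs.isSmooth_slice ht).isContDiff (by simp))
      ((hL.isSmooth_slice ht).isContDiff (by simp)) (hdiv t ht)

end Ansatz

/-! ## §A3 `ApproximateSolution` from estimates on the linearised response -/

/-- **`ApproximateSolution P r` reduced to LINEAR estimates** (the stub `stub_approximateSolution` minus all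
Navier–Stokes bookkeeping).  Suppose that for every lag `A` and `ε > 0`, for all small `ν`, the linearised
response `L` to the heat-lag source `νΔū` — a classical solution of `∂ₜL + (ū·∇)L + (L·∇)ū = νΔL − ∇q + νΔū`,
`div L = 0`, `L(0) = 0` on `[0,1) × 𝕋²` — satisfies on the window `[0, T]`, `T = horizon r ν A`: a continuous
pointwise strain bound `⟪ξ,(ξ·∇)L⟫ ≤ Λ_L ‖ξ‖²`, the `L²` smallness `∫₀ᵀ‖L‖² ≤ εν`, and the Duhamel–Grönwall
smallness `(∫₀ᵗ e^{∫ₛᵗ(½Σrate + Λ_L)⁺} ‖(L·∇)L(s)‖ ds)² ≤ εν` for `t ≤ T`.  Then `ApproximateSolution P r` holds with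
the witness `U = ū + L`, `ρ = (L·∇)L`, `Λ = ½Σⱼ(rateH j + rateV j) + Λ_L` (Grenier 2000 §2–3). [folklore] -/
theorem approximateSolution_of_linearisedResponse (P : CascadeParams) (hγ : 0 ≤ P.γ) (hδ₀ : 0 < P.δ₀)
    (hd : 0 < P.d) {r : ℝ}
    (h : ∀ A : ℕ, ∀ ε : ℝ, 0 < ε → ∃ ν₀ : ℝ, 0 < ν₀ ∧ ∀ ν ∈ Ioc 0 ν₀,
      ∃ (L : ℝ → UnitAddTorus (Fin 2) → EuclideanSpace ℝ (Fin 2)) (q : ℝ → UnitAddTorus (Fin 2) → ℝ)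
        (ΛL : ℝ → ℝ),
        FunctionSpaces.Torus.IsSmoothSpaceTimeOn (Ico (0 : ℝ) 1) L ∧
        FunctionSpaces.Torus.IsSmoothSpaceTimeOn (Ico (0 : ℝ) 1) q ∧
        (∀ t ∈ Ico (0 : ℝ) 1, FunctionSpaces.Torus.IsDivFree (L t)) ∧ L 0 = 0 ∧
        (∀ t ∈ Ico (0 : ℝ) 1, ∀ x,
          FunctionSpaces.Torus.timeDerivWithin (Ico (0 : ℝ) 1) L t x +
              FunctionSpaces.Torus.convect (P.field t) (L t) x + FunctionSpaces.Torus.convect (L t) (P.field t) x =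
            ν • FunctionSpaces.Torus.laplacian (L t) x - FunctionSpaces.Torus.gradient (q t) x +
              ν • FunctionSpaces.Torus.laplacian (P.field t) x) ∧
        (∀ t ∈ Icc 0 (horizon r ν A), ∀ (x : UnitAddTorus (Fin 2)) (ξ : EuclideanSpace ℝ (Fin 2)),
          ⟪ξ, FunctionSpaces.Torus.convect (fun _ => ξ) (L t) x⟫_ℝ ≤ ΛL t * ‖ξ‖ ^ 2) ∧
        ContinuousOn ΛL (Icc 0 (horizon r ν A)) ∧
        (∫ s in (0 : ℝ)..horizon r ν A, FluidPDE.Torus.vectorL2Sq (L s)) ≤ ε * ν ∧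
        ∀ t ∈ Icc 0 (horizon r ν A),
          duhamelDefect (fun s => (∑' j, (P.rateH j s + P.rateV j s)) / 2 + ΛL s)
            (fun s x => FunctionSpaces.Torus.convect (L s) (L s) x) t ^ 2 ≤ ε * ν) :
    ApproximateSolution P r := by
  intro A ε hε
  obtain ⟨ν₀, hν₀, hν⟩ := h A ε hε
  refine ⟨ν₀, hν₀, fun ν hνm => ?_⟩
  obtain ⟨L, q, ΛL, hL, hq, hdiv, hL0, hlin, hstr, hΛc, hint, hdef⟩ := hν ν hνm
  have hfs : CascadeFieldSmooth P := cascadeFieldSmooth P hδ₀ hd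
  have hU1 : UniqueDiffOn ℝ (Ico (0 : ℝ) 1) := uniqueDiffOn_Ico 0 1
  have hconv : Convex ℝ (Ico (0 : ℝ) 1) := convex_Ico 0 1
  set T := horizon r ν A with hT
  have hT1 : T < 1 := CascadeParams.tStart_lt_one _
  have hI : Icc 0 T ⊆ Ico (0 : ℝ) 1 := fun s hs => ⟨hs.1, hs.2.trans_lt hT1⟩
  have hUL : ∀ s, (fun t x => P.field t x + L t x) s - P.field s = L s := fun s => by
    funext x; simp
  refine ⟨fun t x => P.field t x + L t x, fun t x => FunctionSpaces.Torus.convect (L t) (L t) x, q,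
    fun s => (∑' j, (P.rateH j s + P.rateV j s)) / 2 + ΛL s,
    isClassicalNSSolutionOn_field_add P hδ₀ hd hL hq hdiv hlin, ?_, ?_, ?_, ?_, ?_, ?_, hdef⟩
  · funext x; simp [field_zero P, hL0]
  · intro t ht x ξ
    have ht' : t ∈ Ico (0 : ℝ) 1 := hI ht
    have hF1 : FunctionSpaces.Torus.IsContDiff 1 (P.field t) := (hfs.isSmooth_slice ht').isContDiff (by simp)
    have hL1 : FunctionSpaces.Torus.IsContDiff 1 (L t) := (hL.isSmooth_slice ht').isContDiff (by simp)
    rw [FluidPDE.Torus.convect_add_right (fun _ => ξ) hF1 hL1 x, inner_add_right, add_mul]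
    exact add_le_add (inner_convect_field_le P hγ hδ₀ hd ht' x ξ) (hstr t ht x ξ)
  · exact (continuousOn_rate_sum P hT1).add hΛc
  · have hρ : FunctionSpaces.Torus.IsSmoothSpaceTimeOn (Ico (0 : ℝ) 1)
        (fun s x => FunctionSpaces.Torus.convect (L s) (L s) x) := hL.convect hL hU1
    have hc := (hρ.continuousOn_integral_norm_sq hconv).mono hI
    exact (Real.continuous_sqrt.comp_continuousOn hc).congr fun s _ => rfl
  · simp only [hUL]
    exact ((hL.continuousOn_integral_norm_sq hconv).mono hI).congr fun s _ => rfl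
  · simp only [hUL]; exact hint

end Summit.AnomalousDissipation.AnomalousDissipation.Theorems.SawtoothPulseCascade.DriftFreeApprox

end
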